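/-
Copyright (c) 2026 the pub-hodgecm-mathlib formalisation cell (harness21).  Prover seat hodgecm-mathlib-K2E3-p28 (g0), HCML Track B «K2-LIT» (CLOSE-OUT DAY, strike line L4
`stub_StCharTS`), h413 = `stmt-HodgeConjecture-24833`, line `K2_E3_EllipticInputs`, unit U12 «Characters», PART «SC» (ED. 2) leaf (SC-an)₂
`sig_K2E3SupercuspidalTruncatedCharAnalyticTwo`, road «FC₂», brick (FC-5c₂) = letter NC₂ of ★ `K2E3FinConjAssemblyTwo.finConj₂` ∕ K2E3-p23 (g7)'s
`K2E3SupercuspidalTruncatedCharAnalyticTwoOfLetters` (dealer K2E3-plan (g4) D133, `K2/STATUS.md` 2026-09-04T14:52:25Z).  The `Fin 2` twin of ★ (FC-5c)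
`K2E3TorusNearCollisionBound` (K2E2-p13 (g3)) over the SAME generic engines ★ (FC-5b) §1, ★ (FC-5) §1–§2∕§5, ★ (FC-D).
-/
import Summits.HodgeConjecture.HodgeConjecture.Theorems.K2E3TorusOneAveraging          -- ★ (FC-5b) p857248: §1 GENERIC averaging `measure_mul_setLIntegral_le_measure_mul_iSup`; brings ★ (FC-5) `K2E3DiagonalCollisionMeasure` (`measure_collision02_le`, `measure_sep_le_clampedProfile`, `normAbs_sub_comm`), ★ `continuous_glDiagonal`, ★ `LocalFieldHaar.continuous_normAbs`
import Summits.HodgeConjecture.HodgeConjecture.Theorems.K2E3UnitsDigitFibre            -- ★ (FC-D) p857254 (K2E3-p21 (g4)): `unitsDigitFibre` (BOTH fibres: additive AND the norm fibre `|aσ(a)x − y| ≤ r`), `continuous_of_normAbs_eq`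
import Summits.HodgeConjecture.HodgeConjecture.Theorems.K2E3HC14EllU11Elliptic         -- ★ (K2E3-p11 lineage, road «HC-14-ell» at `2 × 2`): `glDiagonal_pair_mem` — `d(a, σ(a)⁻¹) ∈ U(σ, Φ₂)(K)`
import Summits.HodgeConjecture.HodgeConjecture.Theorems.K2E3SplitTorusTwistModuleBound  -- ★ p856900 (K2E3-p20 (g4)): `normAbs_map_eq` (`v ∘ σ = v ⇒ |σ ·| = |·|`)
import Literature.NumberTheory.Automorphic.TateLocalZetaShells                          -- ★ `secondCountableTopology_units` (a Haar measure on `Kˣ` is `SFinite`)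
import HarnessLib

/-!
# h413 ∕ Track B «K2-LIT», (SC-an)₂ leaf, road «FC₂» — brick (FC-5c₂) = letter NC₂: «`μ(B ∩ {near-collision at scale ε}) ≤ C·(ε∕ρ)^κ·μ(B)`» ON `U(σ, Φ₂)(K)`
# (Harish-Chandra 1970, Part VII §2 p. 69; Rogawski 1990, §1.10 p. 9 — the rank-one twin of ★ (FC-5c))

Cell `pub/hodgecm-mathlib`, Track B «K2-LIT», crux H413 = `stmt-HodgeConjecture-24833` (lane `--supports … --as helper`, count-neutral).  THEOREMS ONLY (no `def`,
no `instance`, no `notation`, no named-fact hypothesis, no `sorry`).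

WHAT.  ★ `K2E3FinConjAssemblyTwo.finConj₂` ((FC)₂ on the model `U = U(σ, Φ₂)(K)`, K2E3-p23 (g7)) takes five `2 × 2` letters; this file PAYS the letter (FC-5c₂) `hnc` —
in the ∀-closed Type-0 currency of K2E3-p23 (g7)'s `K2E3SupercuspidalTruncatedCharAnalyticTwoOfLetters` binder `hNC`, with the single token `[CharZero K]` added to its
∀-prefix (★ (FC-D) `unitsDigitFibre` is a characteristic-zero theorem; the N = 3 frame ★ FC-8 `K2E3FinConjRankOne.finConj` carries `[CharZero K]` likewise; the only
instantiation is `K := L_w`, of characteristic zero):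
**`measure_inter_nearCollision_le_two`** — for `K` a non-archimedean local field of characteristic zero (`Valued K ℤᵐ⁰` + compatible `ValuativeRel`), `σ` an involution
with `v ∘ σ = v`, `J = Φ₂`, `μ` any Haar measure on `U` (second countable, locally compact): `∃ κ > 0, ∃ C ≠ ⊤, ∀ ρ > 0, ∀ ε, ∀ B ⊆ U` measurable with `t • B = B` for
every `t ∈ U` of the form `d(a', σ(a')⁻¹)`, `|a'| = 1`, and `ρ ≤ |g₀₀|, |g₁₁|` on `B`: `μ(B ∩ {g | ∃ i ≠ j, |g_ii − g_jj| ≤ ε}) ≤ C · (ε∕ρ)^κ · μ(B)`.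

THE MATHEMATICS (the `Fin 2` twin of ★ (FC-5c) = ★ (FC-5b) ∘ ★ (FC-5) ∘ ★ (FC-D), one clause instead of three).  Left multiplication by `t_a = d(a, σ(a)⁻¹)` scales
`g₀₀ ↦ a·g₀₀` and `g₁₁ ↦ σ(a)⁻¹·g₁₁`, so for `|a| = 1` the single near-collision clause of `t_a·g` reads `|a·g₀₀ − σ(a)⁻¹·g₁₁| ≤ ε ⟺ |aσ(a)·g₀₀ − g₁₁| ≤ ε` (★ (FC-5)
`normAbs_mul_sub_inv_map_mul_eq`): a NORM fibre `{a ∈ 𝒪^× : |aσ(a)·x − y| ≤ ε}`, `|x| ≥ ρ`, whose Haar measure is `≤ max(C_D,1)·(ε∕ρ)^κ·μ'(𝒪^×)` by the SECOND fibre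
bound of ★ (FC-D) `unitsDigitFibre` (clamped to all radii by ★ `measure_sep_le_clampedProfile`, rescaled to `|x| = 1` by ★ `measure_collision02_le`) — the «average over
the norms `a'σ(a')`» of K2E3-p23 (g7)'s R0 (2026-09-04T14:37:27Z) is therefore ALREADY ★, uniformly in `σ` (`σ = id` included).  Averaging over `a ∈ 𝒪^×` by Tonelli on
`Kˣ × U` and the left invariance of `μ` (★ (FC-5b) §1, ANY group) turns the fibre bound into the set bound; `μ'` = `Measure.haar` on `Kˣ` (Borel), `0 < μ'(𝒪^×) < ⊤`
(★ `isOpen_units_valuation_eq_one` ∕ `isCompact_units_valuation_eq_one`), is discharged in-proof exactly as ★ FC-8 `finConj` :116–119 does at N = 3.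
* §1 the torus element `t_a = d(a, σ(a)⁻¹) ∈ U(σ, Φ₂)(K)` (★ `glDiagonal_pair_mem`): the two diagonal entries of `t_a·g`, continuity of `a ↦ t_a`, the one-clause
  reduction `setOf_exists_collision_subset_two`, and the fibre bound over a profile ∕ over ★ (FC-D) (`measure_diagCollision_unitary_le_of_unitsDigitFibre_two`).
* §2 measurability of the near-collision event at `2 × 2` and STEP (v) `unitSphere_mul_measure_inter_nearCollision_le_iSup_two` (★ (FC-5b) §3 at `Fin 2`, over the
  generic §1 BY NAME), `measure_inter_nearCollision_le_of_unitsDigitFibre_two` ∕ `'` (un-cancelled ∕ cancelled).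
* §3 THE LETTER: `measure_inter_nearCollision_le_two` (∀-closed, Type-0 `K`, p23's `hNC` text + `[CharZero K]`).

HONEST LABEL: HC_CM is proved only modulo the 7 printed citations (2 remaining named inputs: hLiu418 = `stmt-HodgeConjecture-24832`, h413 =
`stmt-HodgeConjecture-24833`) until rung 0 closes; count-neutral helper; (SC-an)₂ is NOT ★ by this file (it becomes REL over {COV₂, UP₂, DIAG₂ ★, COLL₂, NC₂ (this file),
(M5h)₂} only when K2E3-p23 (g7)'s assembly ties, and ★ only when every letter incl. the XL (M5h)₂ engine lands).

## References
* [HarishChandra1970] Harish-Chandra (notes by G. van Dijk), *Harmonic Analysis on Reductive p-adic Groups*, LNM 162 (1970), Part VII §2 p. 69; Part VI §8 Thm 14 p. 60.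
* [Rogawski1990] J. D. Rogawski, *Automorphic Representations of Unitary Groups in Three Variables*, Ann. of Math. Stud. 123 (1990), §1.10 p. 9 (`d(α, ᾱ⁻¹)`), §3.6 p. 31.
* [WeilIntegration1965] A. Weil, *L'intégration dans les groupes topologiques et ses applications* (2nd ed., 1965), §7 (invariant integration, Fubini on `G × G`).
* [Serre1979] J.-P. Serre, *Local Fields*, GTM 67 (1979), Ch. II §1, Ch. IV §2.
-/

set_option autoImplicit false
set_option linter.dupNamespace false  -- the mandated namespace repeats the single-problem summit's segment (`HodgeConjecture.HodgeConjecture`)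

noncomputable section

open MeasureTheory Set ValuativeRel Function Literature.NumberTheory.Automorphic Literature.NumberTheory.Automorphic.UnitaryGroup
open Literature.NumberTheory.GaloisRepresentations Literature.NumberTheory.GaloisRepresentations.IsNonarchimedeanLocalField
open Summit.HodgeConjecture.HodgeConjecture.Cruxes.H413.K2E3DiagonalCollisionMeasure Summit.HodgeConjecture.HodgeConjecture.Cruxes.H413.K2E3TorusOneAveraging
open Summit.HodgeConjecture.HodgeConjecture.Cruxes.H413.K2E3HC14EllU11Elliptic (glDiagonal_pair_mem)
open scoped NNReal ENNReal MatrixGroups Pointwise WithZero Valued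

namespace Summit.HodgeConjecture.HodgeConjecture.Cruxes.H413.K2E3TorusNearCollisionBoundTwo

/-! ## §1 The torus element `t_a = d(a, σ(a)⁻¹)` of `U(σ, Φ₂)(K)`: diagonal entries of `t_a·g`, continuity, the one-clause event, the fibre bound -/

section Torus
variable {K : Type*} [Field K] (σ : K →+* K)

/-- The `(0,0)` entry of `t_a · g` is `a · g₀₀` (`t_a = d(a, σ(a)⁻¹)`). [cite: Rogawski1990, §1.10 p. 9] -/
theorem glDiagonal_torusPair_mul_apply_zero (u : Kˣ) (g : Matrix (Fin 2) (Fin 2) K) :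
    ((glDiagonal 2 K ![u, (Units.map (σ : K →* K) u)⁻¹] : Matrix (Fin 2) (Fin 2) K) * g) 0 0 = (u : K) * g 0 0 := by
  rw [coe_glDiagonal, Matrix.diagonal_mul]
  rfl

/-- The `(1,1)` entry of `t_a · g` is `σ(a)⁻¹ · g₁₁` (`t_a = d(a, σ(a)⁻¹)`). [cite: Rogawski1990, §1.10 p. 9] -/
theorem glDiagonal_torusPair_mul_apply_one (u : Kˣ) (g : Matrix (Fin 2) (Fin 2) K) :
    ((glDiagonal 2 K ![u, (Units.map (σ : K →* K) u)⁻¹] : Matrix (Fin 2) (Fin 2) K) * g) 1 1 = (σ u)⁻¹ * g 1 1 := by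
  rw [coe_glDiagonal, Matrix.diagonal_mul]
  show (((Units.map (σ : K →* K) u)⁻¹ : Kˣ) : K) * g 1 1 = (σ u)⁻¹ * g 1 1
  rw [Units.val_inv_eq_inv_val, Units.coe_map, MonoidHom.coe_coe]

/-- `t_{ab} = t_a · t_b` (the torus map `a ↦ d(a, σ(a)⁻¹)` is a homomorphism into `U(σ, Φ₂)(K)`). [cite: Rogawski1990, §1.10 p. 9] -/
theorem torusPair_mul (hσ : ∀ x, σ (σ x) = x) {J : Matrix (Fin 2) (Fin 2) K} (hJ : J = (StdForm.antidiagonal 2).over K) (a b : Kˣ) :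
    (⟨glDiagonal 2 K ![a * b, (Units.map (σ : K →* K) (a * b))⁻¹], glDiagonal_pair_mem σ hσ hJ (a * b)⟩ : ↥(unitaryGroupOfForm σ J)) =
      ⟨glDiagonal 2 K ![a, (Units.map (σ : K →* K) a)⁻¹], glDiagonal_pair_mem σ hσ hJ a⟩ *
        ⟨glDiagonal 2 K ![b, (Units.map (σ : K →* K) b)⁻¹], glDiagonal_pair_mem σ hσ hJ b⟩ := by
  refine Subtype.ext ?_
  show glDiagonal 2 K ![a * b, (Units.map (σ : K →* K) (a * b))⁻¹] =
    glDiagonal 2 K ![a, (Units.map (σ : K →* K) a)⁻¹] * glDiagonal 2 K ![b, (Units.map (σ : K →* K) b)⁻¹]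
  rw [← map_mul]
  congr 1
  funext i
  have h2 : ∀ k : Fin 2, k = 0 ∨ k = 1 := by decide
  rcases h2 i with rfl | rfl
  · rfl
  · show (Units.map (σ : K →* K) (a * b))⁻¹ = (Units.map (σ : K →* K) a)⁻¹ * (Units.map (σ : K →* K) b)⁻¹
    rw [map_mul, mul_inv]

variable [TopologicalSpace K] [IsTopologicalRing K] (hσ : ∀ x, σ (σ x) = x) {J : Matrix (Fin 2) (Fin 2) K} (hJ : J = (StdForm.antidiagonal 2).over K)
  (hσc : Continuous σ)

include hσc in
/-- **`a ↦ t_a = d(a, σ(a)⁻¹)` is continuous** (`d ↦ diag(d)` is continuous, ★ `continuous_glDiagonal`; `a ↦ (σ a)⁻¹` is continuous on `Kˣ`). [cite: Rogawski1990, §1.10 p. 9] -/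
theorem continuous_torusPair :
    Continuous fun a : Kˣ => (⟨glDiagonal 2 K ![a, (Units.map (σ : K →* K) a)⁻¹], glDiagonal_pair_mem σ hσ hJ a⟩ : ↥(unitaryGroupOfForm σ J)) := by
  refine Continuous.subtype_mk ((continuous_glDiagonal (n := 2) K).comp (continuous_pi fun i => ?_)) _
  have h2 : ∀ k : Fin 2, k = 0 ∨ k = 1 := by decide
  rcases h2 i with rfl | rfl
  · exact continuous_id
  · exact (Continuous.units_map (σ : K →* K) hσc).inv

omit [IsTopologicalRing K] in
/-- The matrix entries `g ↦ g_ij` are continuous on `↥U(σ, J)`. [cite: Rogawski1990, §1.10 p. 9] -/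
theorem continuous_apply_coe_two (i j : Fin 2) :
    Continuous fun g : ↥(unitaryGroupOfForm σ J) => ((g : GL (Fin 2) K) : Matrix (Fin 2) (Fin 2) K) i j :=
  (Units.continuous_val.comp continuous_subtype_val).matrix_elem i j

end Torus

section TorusAbs
variable {K : Type*} [Field K] [ValuativeRel K] [TopologicalSpace K] [IsNonarchimedeanLocalField K] (σ : K →+* K) {A : Type*} (ι : A → Kˣ)

/-- **AT `2 × 2` THE `∃ i ≠ j` COLLISION EVENT IS ONE NORM CLAUSE** (on the unit sphere): for `g : Matrix (Fin 2) (Fin 2) K` with diagonal `(x, y)`,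
`{a ∈ 𝒪^× : ∃ i ≠ j, |(t_{ι a} g)_ii − (t_{ι a} g)_jj| ≤ ε} ⊆ {a ∈ 𝒪^× : |ι a·x − σ(ι a)⁻¹·y| ≤ ε}` (the two ordered pairs; `|p − q| = |q − p|`).
[cite: Rogawski1990, §1.10 p. 9] [cite: HarishChandra1970, Part VII §2 p. 69] -/
theorem setOf_exists_collision_subset_two (g : Matrix (Fin 2) (Fin 2) K) (ε : ℝ≥0) :
    {a | valuation K (ι a : K) = 1 ∧ ∃ i j : Fin 2, i ≠ j ∧
        normAbs K (((glDiagonal 2 K ![ι a, (Units.map (σ : K →* K) (ι a))⁻¹] : Matrix (Fin 2) (Fin 2) K) * g) i i -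
          ((glDiagonal 2 K ![ι a, (Units.map (σ : K →* K) (ι a))⁻¹] : Matrix (Fin 2) (Fin 2) K) * g) j j) ≤ ε} ⊆
      {a | valuation K (ι a : K) = 1 ∧ normAbs K ((ι a : K) * g 0 0 - (σ (ι a : K))⁻¹ * g 1 1) ≤ ε} := by
  rintro a ⟨hv, i, j, hij, h⟩
  refine ⟨hv, ?_⟩
  have h2 : ∀ k : Fin 2, k = 0 ∨ k = 1 := by decide
  rcases h2 i with rfl | rfl <;> rcases h2 j with rfl | rfl
  · exact absurd rfl hij
  · rwa [glDiagonal_torusPair_mul_apply_zero, glDiagonal_torusPair_mul_apply_one] at h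
  · rwa [glDiagonal_torusPair_mul_apply_one, glDiagonal_torusPair_mul_apply_zero, normAbs_sub_comm] at h
  · exact absurd rfl hij

end TorusAbs

section Consumer
variable {K : Type*} [Field K] [ValuativeRel K] [TopologicalSpace K] [IsNonarchimedeanLocalField K]
  (σ : K →+* K) (hσ : ∀ x, σ (σ x) = x) (hσn : ∀ x, normAbs K (σ x) = normAbs K x) {J : Matrix (Fin 2) (Fin 2) K} (hJ : J = (StdForm.antidiagonal 2).over K)
  {A : Type*} [MeasurableSpace A] (ν : Measure A) (ι : A → Kˣ) (Φ : ℝ≥0 → ℝ≥0∞)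
  (hnorm : ∀ (r : ℝ≥0) (y : K), ν {a | valuation K (ι a : K) = 1 ∧ normAbs K ((ι a : K) * σ (ι a : K) - y) ≤ r} ≤ Φ r)

include hσn hnorm in
/-- **(FC-5)₂, MATRIX CURRENCY**: for `g : Matrix (Fin 2) (Fin 2) K` with `0 < ρ ≤ |g₀₀|` and every `ε`,
`ν{a ∈ 𝒪^× : ∃ i ≠ j, |(t_{ι a}·g)_ii − (t_{ι a}·g)_jj| ≤ ε} ≤ Φ(ε∕ρ)`, `t_u = d(u, σ(u)⁻¹)` — ONE norm clause (★ `measure_collision02_le`), where N = 3 needed three.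
[cite: HarishChandra1970, Part VII §2 p. 69] [cite: Rogawski1990, §1.10 p. 9] -/
theorem measure_diagCollision_matrix_le_of_profile_two {ρ : ℝ≥0} (hρ : 0 < ρ) (g : Matrix (Fin 2) (Fin 2) K)
    (hg0 : ρ ≤ normAbs K (g 0 0)) (ε : ℝ≥0) :
    ν {a | valuation K (ι a : K) = 1 ∧ ∃ i j : Fin 2, i ≠ j ∧
        normAbs K (((glDiagonal 2 K ![ι a, (Units.map (σ : K →* K) (ι a))⁻¹] : Matrix (Fin 2) (Fin 2) K) * g) i i -
          ((glDiagonal 2 K ![ι a, (Units.map (σ : K →* K) (ι a))⁻¹] : Matrix (Fin 2) (Fin 2) K) * g) j j) ≤ ε} ≤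
      Φ (ε / ρ) :=
  (measure_mono (setOf_exists_collision_subset_two σ ι g ε)).trans (measure_collision02_le σ hσn ν ι Φ hnorm hρ hg0 (g 1 1) ε)

include hσn hnorm in
/-- **(FC-5)₂, `↥U(σ, Φ₂)` CURRENCY**: for `g ∈ U(σ, Φ₂)(K)` whose `(0,0)` entry has `|·| ≥ ρ > 0`, the torus elements `t_{ι a} = ⟨d(ι a, σ(ι a)⁻¹), _⟩ ∈ U` satisfy
`ν{a ∈ 𝒪^× : ∃ i ≠ j, |(t_{ι a} * g)_ii − (t_{ι a} * g)_jj| ≤ ε} ≤ Φ(ε∕ρ)` (product in `↥U`). [cite: HarishChandra1970, Part VII §2 p. 69] [cite: Rogawski1990, §1.10 p. 9] -/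
theorem measure_diagCollision_unitary_le_of_profile_two {ρ : ℝ≥0} (hρ : 0 < ρ) (g : ↥(unitaryGroupOfForm σ J))
    (hg0 : ρ ≤ normAbs K (((g : GL (Fin 2) K) : Matrix (Fin 2) (Fin 2) K) 0 0)) (ε : ℝ≥0) :
    ν {a | valuation K (ι a : K) = 1 ∧ ∃ i j : Fin 2, i ≠ j ∧
        normAbs K
          (((((⟨glDiagonal 2 K ![ι a, (Units.map (σ : K →* K) (ι a))⁻¹], glDiagonal_pair_mem σ hσ hJ (ι a)⟩ : ↥(unitaryGroupOfForm σ J)) * g :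
                ↥(unitaryGroupOfForm σ J)) : GL (Fin 2) K) : Matrix (Fin 2) (Fin 2) K) i i -
           ((((⟨glDiagonal 2 K ![ι a, (Units.map (σ : K →* K) (ι a))⁻¹], glDiagonal_pair_mem σ hσ hJ (ι a)⟩ : ↥(unitaryGroupOfForm σ J)) * g :
                ↥(unitaryGroupOfForm σ J)) : GL (Fin 2) K) : Matrix (Fin 2) (Fin 2) K) j j) ≤ ε} ≤
      Φ (ε / ρ) := by
  have h := measure_diagCollision_matrix_le_of_profile_two σ hσn ν ι Φ hnorm hρ ((g : GL (Fin 2) K) : Matrix (Fin 2) (Fin 2) K) hg0 ε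
  simpa only [Subgroup.coe_mul, Units.val_mul] using h

end Consumer

section UnitsDigitFibre
variable {K : Type*} [Field K] [ValuativeRel K] [TopologicalSpace K] [IsNonarchimedeanLocalField K]
  (σ : K →+* K) (hσ : ∀ x, σ (σ x) = x) (hσn : ∀ x, normAbs K (σ x) = normAbs K x) {J : Matrix (Fin 2) (Fin 2) K} (hJ : J = (StdForm.antidiagonal 2).over K)
  [MeasurableSpace Kˣ] (μ' : Measure Kˣ)

include hσn in
/-- **(FC-5)₂ OVER (FC-D)**: given (FC-D)'s conclusion `hD` for the ambient `K, σ, μ'` (★ `K2E3UnitsDigitFibre.unitsDigitFibre σ hσ hσn μ'`; only its SECOND, norm-fibre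
clause is used at `2 × 2`), there are `κ > 0` and `C ≠ ⊤` (namely `max(C_D, 1)`, same `κ`) such that for every `ρ > 0`, every `ε`, and every `g ∈ U(σ, Φ₂)(K)` with
`ρ ≤ |g₀₀|`: `μ'{a ∈ 𝒪^× : ∃ i ≠ j, |(t_a * g)_ii − (t_a * g)_jj| ≤ ε} ≤ C · (ε∕ρ)^κ · μ'(𝒪^×)`, `t_a = ⟨d(a, σ(a)⁻¹), _⟩ ∈ U`, `𝒪^× = {a : Kˣ | valuation K a = 1}`.
[cite: HarishChandra1970, Part VII §2 p. 69] [cite: Rogawski1990, §1.10 p. 9] -/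
theorem measure_diagCollision_unitary_le_of_unitsDigitFibre_two
    (hD : ∃ κ : ℝ, 0 < κ ∧ ∃ C : ℝ≥0∞, C ≠ ⊤ ∧ ∀ r : ℝ≥0, r ≤ 1 → ∀ x y : K, normAbs K x = 1 →
      μ' {a : Kˣ | valuation K ↑a = 1 ∧ normAbs K (↑a * x - y) ≤ r} ≤ C * (r : ℝ≥0∞) ^ κ * μ' {a : Kˣ | valuation K ↑a = 1} ∧
      μ' {a : Kˣ | valuation K ↑a = 1 ∧ normAbs K (↑a * σ ↑a * x - y) ≤ r} ≤ C * (r : ℝ≥0∞) ^ κ * μ' {a : Kˣ | valuation K ↑a = 1}) :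
    ∃ κ : ℝ, 0 < κ ∧ ∃ C : ℝ≥0∞, C ≠ ⊤ ∧ ∀ ρ : ℝ≥0, 0 < ρ → ∀ ε : ℝ≥0,
      ∀ g : ↥(unitaryGroupOfForm σ J), ρ ≤ normAbs K (((g : GL (Fin 2) K) : Matrix (Fin 2) (Fin 2) K) 0 0) →
        μ' {a : Kˣ | valuation K ↑a = 1 ∧ ∃ i j : Fin 2, i ≠ j ∧
            normAbs K
              (((((⟨glDiagonal 2 K ![a, (Units.map (σ : K →* K) a)⁻¹], glDiagonal_pair_mem σ hσ hJ a⟩ : ↥(unitaryGroupOfForm σ J)) * g :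
                    ↥(unitaryGroupOfForm σ J)) : GL (Fin 2) K) : Matrix (Fin 2) (Fin 2) K) i i -
               ((((⟨glDiagonal 2 K ![a, (Units.map (σ : K →* K) a)⁻¹], glDiagonal_pair_mem σ hσ hJ a⟩ : ↥(unitaryGroupOfForm σ J)) * g :
                    ↥(unitaryGroupOfForm σ J)) : GL (Fin 2) K) : Matrix (Fin 2) (Fin 2) K) j j) ≤ ε} ≤
          C * ((ε / ρ : ℝ≥0) : ℝ≥0∞) ^ κ * μ' {a : Kˣ | valuation K ↑a = 1} := by
  obtain ⟨κ, hκ, C, hC, hD⟩ := hD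
  refine ⟨κ, hκ, max C 1, by simp [hC], fun ρ hρ ε g hg0 => ?_⟩
  have hnorm : ∀ (r : ℝ≥0) (y : K), μ' {a : Kˣ | valuation K ((id a : Kˣ) : K) = 1 ∧ normAbs K (((id a : Kˣ) : K) * σ ((id a : Kˣ) : K) - y) ≤ r} ≤
      max C 1 * (r : ℝ≥0∞) ^ κ * μ' {a : Kˣ | valuation K (a : K) = 1} := by
    intro r y
    have h := measure_sep_le_clampedProfile μ' hκ (P := fun r a => normAbs K ((a : K) * σ (a : K) - y) ≤ r)
      (fun r hr => by simpa only [mul_one] using ((hD r hr 1 y (map_one _)).2)) r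
    simpa only [id] using h
  have h := measure_diagCollision_unitary_le_of_profile_two σ hσ hσn hJ μ' id (fun r => max C 1 * (r : ℝ≥0∞) ^ κ * μ' {a : Kˣ | valuation K (a : K) = 1})
    hnorm hρ g hg0 ε
  simpa only [id] using h

end UnitsDigitFibre

/-! ## §2 The near-collision event at `2 × 2` and STEP (v): `μ'(𝒪^×) · μ(B ∩ NearColl_ε) ≤ μ(B) · sup_{g ∈ B} μ'{a ∈ 𝒪^× : t_a g collides} ≤ C·(ε∕ρ)^κ·μ'(𝒪^×)·μ(B)` -/

section Event
variable {K : Type*} [Field K] [ValuativeRel K] [TopologicalSpace K] [IsNonarchimedeanLocalField K] (σ : K →+* K) {J : Matrix (Fin 2) (Fin 2) K}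
  [MeasurableSpace ↥(unitaryGroupOfForm σ J)] [BorelSpace ↥(unitaryGroupOfForm σ J)]

/-- **THE NEAR-COLLISION EVENT IS MEASURABLE** (`2 × 2`): `{g ∈ U | ∃ i ≠ j, |g_ii − g_jj| ≤ ε}` is a finite union of closed sets (`‖·‖_K` and the entries are continuous).
[cite: HarishChandra1970, Part VII §2 p. 69] -/
theorem measurableSet_nearCollision_two (ε : ℝ≥0) :
    MeasurableSet {g : ↥(unitaryGroupOfForm σ J) | ∃ i j : Fin 2, i ≠ j ∧
      normAbs K (((g : GL (Fin 2) K) : Matrix (Fin 2) (Fin 2) K) i i - ((g : GL (Fin 2) K) : Matrix (Fin 2) (Fin 2) K) j j) ≤ ε} := by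
  have hset : {g : ↥(unitaryGroupOfForm σ J) | ∃ i j : Fin 2, i ≠ j ∧
      normAbs K (((g : GL (Fin 2) K) : Matrix (Fin 2) (Fin 2) K) i i - ((g : GL (Fin 2) K) : Matrix (Fin 2) (Fin 2) K) j j) ≤ ε} =
      ⋃ i : Fin 2, ⋃ j : Fin 2, {g : ↥(unitaryGroupOfForm σ J) | i ≠ j ∧
        normAbs K (((g : GL (Fin 2) K) : Matrix (Fin 2) (Fin 2) K) i i - ((g : GL (Fin 2) K) : Matrix (Fin 2) (Fin 2) K) j j) ≤ ε} := by
    ext g; simp only [mem_setOf_eq, mem_iUnion]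
  rw [hset]
  refine MeasurableSet.iUnion fun i => MeasurableSet.iUnion fun j => ?_
  by_cases hij : i = j
  · have he : {g : ↥(unitaryGroupOfForm σ J) | i ≠ j ∧
        normAbs K (((g : GL (Fin 2) K) : Matrix (Fin 2) (Fin 2) K) i i - ((g : GL (Fin 2) K) : Matrix (Fin 2) (Fin 2) K) j j) ≤ ε} = ∅ :=
      eq_empty_of_forall_notMem fun g hg => hg.1 hij
    rw [he]; exact MeasurableSet.empty
  · have he : {g : ↥(unitaryGroupOfForm σ J) | i ≠ j ∧
        normAbs K (((g : GL (Fin 2) K) : Matrix (Fin 2) (Fin 2) K) i i - ((g : GL (Fin 2) K) : Matrix (Fin 2) (Fin 2) K) j j) ≤ ε} =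
        {g : ↥(unitaryGroupOfForm σ J) |
          normAbs K (((g : GL (Fin 2) K) : Matrix (Fin 2) (Fin 2) K) i i - ((g : GL (Fin 2) K) : Matrix (Fin 2) (Fin 2) K) j j) ≤ ε} := by
      ext g; exact ⟨fun h => h.2, fun h => ⟨hij, h⟩⟩
    rw [he]
    exact (isClosed_le (LocalFieldHaar.continuous_normAbs.comp ((continuous_apply_coe_two σ i i).sub (continuous_apply_coe_two σ j j)))
      continuous_const).measurableSet

end Event

section StepV
variable {K : Type*} [Field K] [ValuativeRel K] [TopologicalSpace K] [IsNonarchimedeanLocalField K]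
  (σ : K →+* K) (hσ : ∀ x, σ (σ x) = x) (hσc : Continuous σ) (hσn : ∀ x, normAbs K (σ x) = normAbs K x)
  {J : Matrix (Fin 2) (Fin 2) K} (hJ : J = (StdForm.antidiagonal 2).over K)
  [MeasurableSpace Kˣ] [BorelSpace Kˣ] (μ' : Measure Kˣ) [SFinite μ']
  [MeasurableSpace ↥(unitaryGroupOfForm σ J)] [BorelSpace ↥(unitaryGroupOfForm σ J)] [SecondCountableTopology ↥(unitaryGroupOfForm σ J)]
  (μ : Measure ↥(unitaryGroupOfForm σ J)) [μ.IsMulLeftInvariant] [SFinite μ]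

include hσc in
/-- **STEP (v), PROFILE-FREE FORM** (`2 × 2`): for every measurable `B ⊆ U` invariant under the `𝒪^×`-torus (`t_a • B = B` for `valuation a = 1`, `t_a = d(a, σ(a)⁻¹)`) and
every `ε`, `μ'(𝒪^×) · μ(B ∩ NearColl_ε) ≤ μ(B) · sup_{g ∈ B} μ'{a ∈ 𝒪^× : ∃ i ≠ j, |(t_a g)_ii − (t_a g)_jj| ≤ ε}` (★ (FC-5b) §1 with `f = 1_{NearColl}`, Tonelli on
`Kˣ × U`). [cite: HarishChandra1970, Part VII §2 p. 69] [cite: WeilIntegration1965, §7] -/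
theorem unitSphere_mul_measure_inter_nearCollision_le_iSup_two
    {B : Set ↥(unitaryGroupOfForm σ J)} (hBm : MeasurableSet B)
    (hB : ∀ a : Kˣ, valuation K (a : K) = 1 →
      (⟨glDiagonal 2 K ![a, (Units.map (σ : K →* K) a)⁻¹], glDiagonal_pair_mem σ hσ hJ a⟩ : ↥(unitaryGroupOfForm σ J)) • B = B) (ε : ℝ≥0) :
    μ' {a : Kˣ | valuation K (a : K) = 1} *
        μ (B ∩ {g | ∃ i j : Fin 2, i ≠ j ∧
          normAbs K (((g : GL (Fin 2) K) : Matrix (Fin 2) (Fin 2) K) i i - ((g : GL (Fin 2) K) : Matrix (Fin 2) (Fin 2) K) j j) ≤ ε}) ≤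
      μ B * ⨆ g ∈ B, μ' {a : Kˣ | valuation K (a : K) = 1 ∧ ∃ i j : Fin 2, i ≠ j ∧
        normAbs K
          (((((⟨glDiagonal 2 K ![a, (Units.map (σ : K →* K) a)⁻¹], glDiagonal_pair_mem σ hσ hJ a⟩ : ↥(unitaryGroupOfForm σ J)) * g :
                ↥(unitaryGroupOfForm σ J)) : GL (Fin 2) K) : Matrix (Fin 2) (Fin 2) K) i i -
           ((((⟨glDiagonal 2 K ![a, (Units.map (σ : K →* K) a)⁻¹], glDiagonal_pair_mem σ hσ hJ a⟩ : ↥(unitaryGroupOfForm σ J)) * g :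
                ↥(unitaryGroupOfForm σ J)) : GL (Fin 2) K) : Matrix (Fin 2) (Fin 2) K) j j) ≤ ε} := by
  haveI : IsTopologicalRing K := inferInstance
  set τ : Kˣ → ↥(unitaryGroupOfForm σ J) :=
    fun a => ⟨glDiagonal 2 K ![a, (Units.map (σ : K →* K) a)⁻¹], glDiagonal_pair_mem σ hσ hJ a⟩ with hτ
  set E : Set ↥(unitaryGroupOfForm σ J) := {g | ∃ i j : Fin 2, i ≠ j ∧
    normAbs K (((g : GL (Fin 2) K) : Matrix (Fin 2) (Fin 2) K) i i - ((g : GL (Fin 2) K) : Matrix (Fin 2) (Fin 2) K) j j) ≤ ε} with hE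
  set S : Set Kˣ := {a : Kˣ | valuation K (a : K) = 1} with hS
  have hEm : MeasurableSet E := measurableSet_nearCollision_two σ ε
  have hSm : MeasurableSet S := by
    have hS' : S = ((↑) : Kˣ → K) ⁻¹' {x | normAbs K x = 1} := by
      ext a; simp only [hS, mem_setOf_eq, mem_preimage, normAbs_eq_one_iff_valuation_eq_one]
    rw [hS']
    exact ((isClosed_eq LocalFieldHaar.continuous_normAbs continuous_const).preimage Units.continuous_val).measurableSet
  have hτc : Continuous τ := continuous_torusPair σ hσ hJ hσc
  have hm : Continuous fun p : Kˣ × ↥(unitaryGroupOfForm σ J) => τ p.1 * p.2 := (hτc.comp continuous_fst).mul continuous_snd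
  have hF : Measurable fun p : Kˣ × ↥(unitaryGroupOfForm σ J) => E.indicator (fun _ => (1 : ℝ≥0∞)) (τ p.1 * p.2) :=
    (measurable_const.indicator hEm).comp hm.measurable
  have key := measure_mul_setLIntegral_le_measure_mul_iSup μ τ hBm (fun a ha => hB a ha) μ' hSm hF
  have hlhs : ∫⁻ x in B, E.indicator (fun _ => (1 : ℝ≥0∞)) x ∂μ = μ (B ∩ E) := by
    rw [lintegral_indicator_const hEm, Measure.restrict_apply hEm, one_mul, inter_comm]
  have hrhs : ∀ g, ∫⁻ a in S, E.indicator (fun _ => (1 : ℝ≥0∞)) (τ a * g) ∂μ' = μ' {a : Kˣ | valuation K (a : K) = 1 ∧ τ a * g ∈ E} := by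
    intro g
    have hpre : MeasurableSet ((fun a => τ a * g) ⁻¹' E) := hEm.preimage (hτc.mul continuous_const).measurable
    have hind : (fun a => E.indicator (fun _ => (1 : ℝ≥0∞)) (τ a * g)) = ((fun a => τ a * g) ⁻¹' E).indicator (fun _ => (1 : ℝ≥0∞)) := by
      funext a
      by_cases h : τ a * g ∈ E
      · rw [indicator_of_mem h, indicator_of_mem (show a ∈ (fun a => τ a * g) ⁻¹' E from h)]
      · rw [indicator_of_notMem h, indicator_of_notMem (show a ∉ (fun a => τ a * g) ⁻¹' E from h)]
    rw [hind, lintegral_indicator_const hpre, Measure.restrict_apply hpre, one_mul]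
    congr 1
    ext a
    simp only [mem_inter_iff, mem_preimage, hS, mem_setOf_eq]
    exact and_comm
  rw [hlhs] at key
  exact key.trans (mul_le_mul' le_rfl (iSup₂_mono fun g _ => (hrhs g).le))

include hσc hσn in
/-- **STEP (v) OVER (FC-D)** (`2 × 2`): given (FC-D)'s conclusion `hD` at the ambient `K, σ, μ'`, there are `κ > 0` and `C ≠ ⊤` such that for every `ρ > 0`, every `ε`, and every
measurable `𝒪^×`-torus-invariant `B ⊆ U(σ, Φ₂)(K)` whose elements have `|g₀₀|, |g₁₁| ≥ ρ`: `μ'(𝒪^×) · μ(B ∩ NearColl_ε) ≤ C · (ε∕ρ)^κ · μ'(𝒪^×) · μ(B)`.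
[cite: HarishChandra1970, Part VII §2 p. 69] [cite: Rogawski1990, §1.10 p. 9] -/
theorem measure_inter_nearCollision_le_of_unitsDigitFibre_two
    (hD : ∃ κ : ℝ, 0 < κ ∧ ∃ C : ℝ≥0∞, C ≠ ⊤ ∧ ∀ r : ℝ≥0, r ≤ 1 → ∀ x y : K, normAbs K x = 1 →
      μ' {a : Kˣ | valuation K ↑a = 1 ∧ normAbs K (↑a * x - y) ≤ r} ≤ C * (r : ℝ≥0∞) ^ κ * μ' {a : Kˣ | valuation K ↑a = 1} ∧
      μ' {a : Kˣ | valuation K ↑a = 1 ∧ normAbs K (↑a * σ ↑a * x - y) ≤ r} ≤ C * (r : ℝ≥0∞) ^ κ * μ' {a : Kˣ | valuation K ↑a = 1}) :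
    ∃ κ : ℝ, 0 < κ ∧ ∃ C : ℝ≥0∞, C ≠ ⊤ ∧ ∀ ρ : ℝ≥0, 0 < ρ → ∀ ε : ℝ≥0,
      ∀ B : Set ↥(unitaryGroupOfForm σ J), MeasurableSet B →
        (∀ a : Kˣ, valuation K (a : K) = 1 →
          (⟨glDiagonal 2 K ![a, (Units.map (σ : K →* K) a)⁻¹], glDiagonal_pair_mem σ hσ hJ a⟩ : ↥(unitaryGroupOfForm σ J)) • B = B) →
        (∀ g ∈ B, ρ ≤ normAbs K (((g : GL (Fin 2) K) : Matrix (Fin 2) (Fin 2) K) 0 0) ∧ ρ ≤ normAbs K (((g : GL (Fin 2) K) : Matrix (Fin 2) (Fin 2) K) 1 1)) →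
        μ' {a : Kˣ | valuation K (a : K) = 1} *
            μ (B ∩ {g | ∃ i j : Fin 2, i ≠ j ∧
              normAbs K (((g : GL (Fin 2) K) : Matrix (Fin 2) (Fin 2) K) i i - ((g : GL (Fin 2) K) : Matrix (Fin 2) (Fin 2) K) j j) ≤ ε}) ≤
          C * ((ε / ρ : ℝ≥0) : ℝ≥0∞) ^ κ * μ' {a : Kˣ | valuation K (a : K) = 1} * μ B := by
  obtain ⟨κ, hκ, C, hC, h5⟩ := measure_diagCollision_unitary_le_of_unitsDigitFibre_two σ hσ hσn hJ μ' hD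
  refine ⟨κ, hκ, C, hC, fun ρ hρ ε B hBm hB hρB => ?_⟩
  refine (unitSphere_mul_measure_inter_nearCollision_le_iSup_two σ hσ hσc hJ μ' μ hBm hB ε).trans ?_
  rw [mul_comm (C * _ * _) (μ B)]
  refine mul_le_mul' le_rfl (iSup₂_le fun g hg => ?_)
  exact h5 ρ hρ ε g (hρB g hg).1

include hσc hσn in
/-- **STEP (v), CANCELLED FORM** (`2 × 2`): if moreover `0 < μ'(𝒪^×) < ⊤` (any Haar measure of `Kˣ`: the unit sphere is compact open), then for the same `κ`, `C`:
`μ(B ∩ NearColl_ε) ≤ C · (ε∕ρ)^κ · μ(B)`. [cite: HarishChandra1970, Part VII §2 p. 69] [cite: Rogawski1990, §1.10 p. 9] -/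
theorem measure_inter_nearCollision_le_of_unitsDigitFibre_two' (hS0 : μ' {a : Kˣ | valuation K (a : K) = 1} ≠ 0) (hS : μ' {a : Kˣ | valuation K (a : K) = 1} ≠ ⊤)
    (hD : ∃ κ : ℝ, 0 < κ ∧ ∃ C : ℝ≥0∞, C ≠ ⊤ ∧ ∀ r : ℝ≥0, r ≤ 1 → ∀ x y : K, normAbs K x = 1 →
      μ' {a : Kˣ | valuation K ↑a = 1 ∧ normAbs K (↑a * x - y) ≤ r} ≤ C * (r : ℝ≥0∞) ^ κ * μ' {a : Kˣ | valuation K ↑a = 1} ∧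
      μ' {a : Kˣ | valuation K ↑a = 1 ∧ normAbs K (↑a * σ ↑a * x - y) ≤ r} ≤ C * (r : ℝ≥0∞) ^ κ * μ' {a : Kˣ | valuation K ↑a = 1}) :
    ∃ κ : ℝ, 0 < κ ∧ ∃ C : ℝ≥0∞, C ≠ ⊤ ∧ ∀ ρ : ℝ≥0, 0 < ρ → ∀ ε : ℝ≥0,
      ∀ B : Set ↥(unitaryGroupOfForm σ J), MeasurableSet B →
        (∀ a : Kˣ, valuation K (a : K) = 1 →
          (⟨glDiagonal 2 K ![a, (Units.map (σ : K →* K) a)⁻¹], glDiagonal_pair_mem σ hσ hJ a⟩ : ↥(unitaryGroupOfForm σ J)) • B = B) →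
        (∀ g ∈ B, ρ ≤ normAbs K (((g : GL (Fin 2) K) : Matrix (Fin 2) (Fin 2) K) 0 0) ∧ ρ ≤ normAbs K (((g : GL (Fin 2) K) : Matrix (Fin 2) (Fin 2) K) 1 1)) →
        μ (B ∩ {g | ∃ i j : Fin 2, i ≠ j ∧
            normAbs K (((g : GL (Fin 2) K) : Matrix (Fin 2) (Fin 2) K) i i - ((g : GL (Fin 2) K) : Matrix (Fin 2) (Fin 2) K) j j) ≤ ε}) ≤
          C * ((ε / ρ : ℝ≥0) : ℝ≥0∞) ^ κ * μ B := by
  obtain ⟨κ, hκ, C, hC, h⟩ := measure_inter_nearCollision_le_of_unitsDigitFibre_two σ hσ hσc hσn hJ μ' μ hD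
  refine ⟨κ, hκ, C, hC, fun ρ hρ ε B hBm hB hρB => ?_⟩
  have key := h ρ hρ ε B hBm hB hρB
  rw [mul_comm (C * _) (μ' _), mul_assoc (μ' _)] at key
  exact (ENNReal.mul_le_mul_iff_right hS0 hS).1 key

end StepV

/-! ## §3 THE LETTER NC₂ (FC-5c₂): the ∀-closed, `μ'`-free, Type-0 form consumed by K2E3-p23 (g7)'s `sigSCanTwo_of_letters` ∕ ★ `finConj₂` -/

/-- **(FC-5c₂) — THE LETTER NC₂ OF ROAD «FC₂», UNCONDITIONAL** (K2E3-p23 (g7)'s binder `hNC` of `K2E3SupercuspidalTruncatedCharAnalyticTwoOfLetters.finConjPlace_two_of_letters`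
∕ `sigSCanTwo_of_letters`, ∀-closed over the model frame, Type-0 `K`, with the one token `[CharZero K]` added to the ∀-prefix — ★ (FC-D) is a characteristic-zero theorem,
as is the N = 3 frame ★ FC-8 `finConj` :78; the only instantiation is `K := L_w`).  For `K` a non-archimedean local field of characteristic zero (`Valued K ℤᵐ⁰`, compatible
`ValuativeRel`), `σ` an involution with `v ∘ σ = v`, `ϖ` a uniformiser (idle here, part of the frozen frame), `J = Φ₂`, `μ` a Haar measure on `U = U(σ, J)(K)` (second
countable, locally compact): **`∃ κ > 0, ∃ C ≠ ⊤, ∀ ρ > 0, ∀ ε, ∀ B ⊆ U` measurable with `t • B = B` for every `t ∈ U` with `↑t = d(a', σ(a')⁻¹)`, `valuation a' = 1`, and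
`ρ ≤ |g₀₀|, |g₁₁|` on `B`: `μ(B ∩ {g | ∃ i ≠ j, |g_ii − g_jj| ≤ ε}) ≤ C · (ε∕ρ)^κ · μ(B)`** — §2's cancelled form at `μ' := Measure.haar` on `Kˣ` (Borel; `0 < μ'(𝒪^×) < ⊤` by
★ `isOpen_units_valuation_eq_one` ∕ `isCompact_units_valuation_eq_one`), `hσn := normAbs_map_eq σ hσv`, `hσc := continuous_of_normAbs_eq`, `hD := unitsDigitFibre`; the
`∃ a'`-described torus hypothesis is fed the literal `⟨d(a, σ(a)⁻¹), glDiagonal_pair_mem⟩`.  The rank-one twin of ★ (FC-5c) `K2E3TorusNearCollisionBound.measure_inter_nearCollision_le`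
inside ★ FC-8 `finConj` :116–119. [cite: HarishChandra1970, Part VII §2 p. 69] [cite: Rogawski1990, §1.10 p. 9] [cite: WeilIntegration1965, §7] -/
theorem measure_inter_nearCollision_le_two :
    ∀ (K : Type) [Field K] [Valued K ℤᵐ⁰] [ValuativeRel K] [(Valued.v : Valuation K ℤᵐ⁰).Compatible] [IsNonarchimedeanLocalField K] [CharZero K]
      (σ : K →+* K), (∀ x, σ (σ x) = x) → (∀ x, Valued.v (σ x) = Valued.v x) → ∀ {ϖ : K}, Valued.v ϖ = WithZero.exp (-1 : ℤ) →
      ∀ {J : Matrix (Fin 2) (Fin 2) K}, J = (StdForm.antidiagonal 2).over K →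
      ∀ [MeasurableSpace ↥(unitaryGroupOfForm σ J)] [BorelSpace ↥(unitaryGroupOfForm σ J)] [SecondCountableTopology ↥(unitaryGroupOfForm σ J)] [LocallyCompactSpace ↥(unitaryGroupOfForm σ J)]
        (μ : Measure ↥(unitaryGroupOfForm σ J)) [μ.IsHaarMeasure],
      ∃ κ : ℝ, 0 < κ ∧ ∃ C : ℝ≥0∞, C ≠ ⊤ ∧ ∀ ρ : ℝ≥0, 0 < ρ → ∀ ε : ℝ≥0,
        ∀ B : Set ↥(unitaryGroupOfForm σ J), MeasurableSet B →
          (∀ t : ↥(unitaryGroupOfForm σ J),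
            (∃ a' : Kˣ, valuation K (a' : K) = 1 ∧ (t : GL (Fin 2) K) = glDiagonal 2 K ![a', (Units.map (σ : K →* K) a')⁻¹]) → t • B = B) →
          (∀ g ∈ B, ρ ≤ normAbs K (((g : GL (Fin 2) K) : Matrix (Fin 2) (Fin 2) K) 0 0) ∧ ρ ≤ normAbs K (((g : GL (Fin 2) K) : Matrix (Fin 2) (Fin 2) K) 1 1)) →
          μ (B ∩ {g | ∃ i j : Fin 2, i ≠ j ∧ normAbs K (((g : GL (Fin 2) K) : Matrix (Fin 2) (Fin 2) K) i i - ((g : GL (Fin 2) K) : Matrix (Fin 2) (Fin 2) K) j j) ≤ ε}) ≤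
            C * ((ε / ρ : ℝ≥0) : ℝ≥0∞) ^ κ * μ B := by
  intro K _ _ _ _ _ _ σ hσ hσv ϖ _hϖ J hJ _ _ _ _ μ _
  have hσn : ∀ x, normAbs K (σ x) = normAbs K x := K2E3SplitTorusTwistModuleBound.normAbs_map_eq σ hσv
  have hσc : Continuous σ := K2E3UnitsDigitFibre.continuous_of_normAbs_eq σ hσn
  letI : MeasurableSpace Kˣ := borel Kˣ
  haveI : BorelSpace Kˣ := ⟨rfl⟩
  haveI : SecondCountableTopology Kˣ := secondCountableTopology_units K
  obtain ⟨κ, hκ, C, hC, h⟩ := measure_inter_nearCollision_le_of_unitsDigitFibre_two' σ hσ hσc hσn hJ (Measure.haar : Measure Kˣ) μ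
    ((isOpen_units_valuation_eq_one (F := K)).measure_pos Measure.haar ⟨1, by simp⟩).ne'
    ((isCompact_units_valuation_eq_one (F := K)).measure_lt_top (μ := Measure.haar)).ne (K2E3UnitsDigitFibre.unitsDigitFibre σ hσ hσn Measure.haar)
  refine ⟨κ, hκ, C, hC, fun ρ hρ ε B hBm hB hρB => h ρ hρ ε B hBm (fun a ha => hB _ ⟨a, ha, rfl⟩) hρB⟩

end Summit.HodgeConjecture.HodgeConjecture.Cruxes.H413.K2E3TorusNearCollisionBoundTwo

end
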